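import Literature.AlgebraicGeometry.Resolution.PerronTransforms
import Literature.AlgebraicGeometry.Resolution.TranscendenceDefect
import Literature.AlgebraicGeometry.Resolution.AffineModelLU
import Literature.AlgebraicGeometry.Resolution.ValuedFunctionFieldsLemmas
import Literature.AlgebraicGeometry.Resolution.PrimeDivisors
import Mathlib.RingTheory.RegularLocalRing.Polynomial
import HarnessLib

/-!
# Toric local uniformization: the case `K = k(B)` of an Abhyankar valuation (Temkin 2013, §5.1, §5.3)

Topic: `Literature/AlgebraicGeometry/Resolution`. A PROVED leaf below the named fact `Temkin2013`
(`LocalUniformization.lean`; M. Temkin, *Inseparable local uniformization*, J. Algebra 373 (2013)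
65–119 = arXiv:0804.1554v3, Thm. 1.3.2), on the branch of Abhyankar valuations (the induction
base `D_{K/k} = 0` of Thm. 4.1.1 = Thm. 5.5.2; named facts `Temkin2013DescentAbhyankar`,
`Temkin2013Abhyankar`): the **toric case** of §5.1 (p. 51: "In order to uniformize an Abhyankar
`K` we choose an Abhyankar basis `B = B_E ⊔ B_F` and set `K_B = k(B)`. If `K = K_B` then `K` can
be uniformized by toric geometry (i.e. essentially combinatorially). Namely, we will see that
in this case `K°` is the filtered union of regular local rings `O_{B,M} = ∪_M k(B_F)[M]_m`, where
`M` runs through free monoids in the valuation monoid `Λ_B ∩ K°`, `Λ_B` is the lattice in `K^×`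
generated by `B_E` and `m` is the ideal of `k(B_F)[M]` generated by `M ∖ {1}`. We will construct
an affine toric model `A_{B,M}` such that `O_{B,M}` is the local ring of the center
`η_{B,M} ∈ A_{B,M}` of `K°`, and for a large enough `M` a neighborhood of `η_{B,M}` will turn out
to be finer than any fixed model of `K°`. In particular, this is enough to uniformize `K` when
`K = K_B`"), assembled from Lemma 5.3.2 (p. 55: "For a fixed Abhyankar basis `B` the equality
`K_B° = ∪_{M ⊂ Λ°} O_{B,M}` holds, where `M` runs through all toric monoids in `Λ°`") and
Thm. A.2.1 (p. 63; PROVED in `PerronTransforms.lean`), which makes the monoid `M` free, i.e.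
`k(B_F)[M]_m` a localisation of a polynomial ring.

An Abhyankar system `B = x ⊔ y` over the trivially valued ground field `k ⊆ K°` is rendered as in
`TranscendenceDefect.lean` (Temkin 2013, §2.1, condition (*)): `y : ι → K°` with residues
algebraically independent over `k` (`B_F`) and `x : κ → K^×` whose values are `ℤ`-independent
in the value group (`B_E`; for the trivially valued `k` this is "`|B_E|` maps onto a `ℚ`-basis of
`|K^×| ⊗ ℚ`" up to the harmless passage from a `ℚ`-basis to a `ℤ`-independent set).

## Content (everything PROVED)

* `lmonomial_*`, `valuation_lmonomial` — Laurent monomials `x^d = ∏ xⱼ^{dⱼ}` (`d ∈ ℤ^κ`, as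
  `Finsupp.prod` of `zpow`s; `x^0 = 1` is Mathlib's `Finsupp.prod_zero_index`): multiplicativity
  in `d`, non-vanishing, values.
* `exists_dominant_monomial` — the Gauss (monomial) valuation on `k[y][x]`: a non-zero
  polynomial in `x` over `k[y]` has a unique monomial of maximal value, which is the value of the
  polynomial (proof of Lemma 5.3.2: "`|a| = maxᵢ |mᵢ|` because `|aᵢ| = 1` and the real numbers
  `|mᵢ|` are all different"); `exists_mvPolynomial_aeval_eq`, `exists_aeval_div_aeval_eq` —
  elements of `k[y, x]`, resp. of `k(x, y) ∩ K°`, as polynomials, resp. quotients `a/b` with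
  `|a| ≤ |b|`.
* `exists_toricChart` — **§5.1 + Lemma 5.3.2 + Thm. A.2.1**: for finitely many such quotients
  there are Laurent monomials `z₁, …, z_N` in `x` (a basis change of the exponent lattice `Λ_B`,
  by Perron transforms: `exists_basis_lt_one_of_injective`) of values `< 1` with `(z, y)`
  algebraically independent over `k`, the `xⱼ` Laurent monomials in `z`, and every quotient of the
  form `p/q` with `p, q ∈ k[z, y]`, `|q| = 1`; `exists_regular_toricChart` — the same for finitely
  many elements of `k(B) ∩ K°`, together with: `k[z, y] ⊆ K°` and its local ring at the centre of
  `K°` is a REGULAR local ring (a polynomial ring over a field is a regular ring, Mathlib's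
  `MvPolynomial.isRegularRing_of_isRegularRing`) — "`K_B°` is the filtered union of the regular
  local rings `O_{B,M}`, `M` free".
* `exists_regular_affineModel_of_toric` — **Thm. 1.3.2 for `K = K_B`, with `l = k` and `L = K`,
  refining a prescribed model**: if `K = k(x, y)` then every affine model `A ⊆ K°` is refined by an
  affine model `B = k[z, y][1/q] ⊇ A` inside `K°` with `Frac B = K` whose local ring at the centre
  is regular (sandwich `k[z,y] ⊆ B ⊆ k[z,y]_𝔭`, `isRegularLocalRing_localization_of_sandwich` of
  `AffineModelLU.lean`; `locAway` of `ValuedFunctionFieldsLemmas.lean`).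
* `isLocallyUniformizable_of_toric`, `temkin2013_conclusion_of_toric` — hence `K°` is locally
  uniformizable over `k` and the conclusion of the weak fact `Temkin2013` holds with `L = K`.

## Sources

* M. Temkin, *Inseparable local uniformization*, J. Algebra 373 (2013) 65–119 =
  arXiv:0804.1554v3: §2.1, condition (*) (pp. 9–10); §5.1 (pp. 51–52); §5.3, Lemmas 5.3.1 and
  5.3.2 (pp. 54–56); Thm. A.2.1 (p. 63).

## Rendering notes

* `K = K_B` ↦ `IntermediateField.adjoin k (range y ∪ range x) = ⊤`; the chart `k(B_F)[M]` of the
  source has the FIELD `k(B_F)` of coefficients, its integral version `k[B_F][M] = k[y, z]` is used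
  here (it is an affine `k`-model, which is what Thm. 1.3.2 is about; the local rings at the
  centre agree, as `k[B_F] ∖ {0}` consists of units of `K°`). A free monoid `M ⊂ Λ°` with
  `M^gp = Λ_B` ↦ the monomials in a `ℤ`-basis `e` of the exponent lattice `ℤ^κ ≅ Λ_B` with
  `|x^{eᵢ}| < 1`, `zᵢ = x^{eᵢ}`.
* Valued fields as in the companion files: `O = K°` a `ValuationSubring`, `k ⊆ K°` via
  `[Algebra k O] [IsScalarTower k O K]`; the centre of `K°` on a subalgebra is `centreIdeal`
  (`LocalUniformization.lean`); "`|q| = 1`" ↦ `O.valuation q = 1`.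
-/

noncomputable section

namespace Literature.AlgebraicGeometry.Resolution

open MvPolynomial IsLocalRing

universe u

/-! ### Laurent monomials `x^d = ∏ⱼ xⱼ^{dⱼ}`, `d ∈ ℤ^κ` -/

section LaurentMonomial

variable {K : Type u} [Field K] {κ : Type*} (x : κ → K)

/-- `x^(single j n) = xⱼ^n`. [folklore] -/
theorem lmonomial_single (j : κ) (n : ℤ) :
    (Finsupp.single j n).prod (fun j (n : ℤ) => x j ^ n) = x j ^ n :=
  Finsupp.prod_single_index (zpow_zero _)

/-- Monomials with exponents in `ℕ^κ` are Laurent monomials. [folklore] -/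
theorem lmonomial_natCast (μ : κ →₀ ℕ) :
    (μ.mapRange (fun n : ℕ => (n : ℤ)) (by simp)).prod (fun j (n : ℤ) => x j ^ n) =
      μ.prod fun j (n : ℕ) => x j ^ n := by
  rw [Finsupp.prod_mapRange_index (fun _ => zpow_zero _)]
  simp only [zpow_natCast]

variable (hx0 : ∀ j, x j ≠ 0)
include hx0

/-- `x^(d + d') = x^d · x^(d')` for `xⱼ ≠ 0`. [folklore] -/
theorem lmonomial_add (d d' : κ →₀ ℤ) :
    (d + d').prod (fun j (n : ℤ) => x j ^ n) =
      d.prod (fun j (n : ℤ) => x j ^ n) * d'.prod (fun j (n : ℤ) => x j ^ n) :=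
  Finsupp.prod_add_index' (fun _ => zpow_zero _) (fun j m n => zpow_add₀ (hx0 j) m n)

/-- `x^d ≠ 0`. [folklore] -/
theorem lmonomial_ne_zero (d : κ →₀ ℤ) : d.prod (fun j (n : ℤ) => x j ^ n) ≠ 0 :=
  Finset.prod_ne_zero_iff.mpr fun j _ => zpow_ne_zero _ (hx0 j)

/-- `x^(-d) = (x^d)⁻¹`. [folklore] -/
theorem lmonomial_neg (d : κ →₀ ℤ) :
    (-d).prod (fun j (n : ℤ) => x j ^ n) = (d.prod fun j (n : ℤ) => x j ^ n)⁻¹ := by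
  have h := lmonomial_add x hx0 d (-d)
  rw [add_neg_cancel, Finsupp.prod_zero_index] at h
  exact eq_inv_of_mul_eq_one_right h.symm

/-- `x^(d - d') = x^d · (x^(d'))⁻¹`. [folklore] -/
theorem lmonomial_sub (d d' : κ →₀ ℤ) :
    (d - d').prod (fun j (n : ℤ) => x j ^ n) =
      d.prod (fun j (n : ℤ) => x j ^ n) * (d'.prod fun j (n : ℤ) => x j ^ n)⁻¹ := by
  rw [sub_eq_add_neg, lmonomial_add x hx0, lmonomial_neg x hx0]

/-- `x^(∑ dᵢ) = ∏ x^(dᵢ)`. [folklore] -/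
theorem lmonomial_sum {σ : Type*} (s : Finset σ) (f : σ → κ →₀ ℤ) :
    (∑ i ∈ s, f i).prod (fun j (n : ℤ) => x j ^ n) =
      ∏ i ∈ s, (f i).prod (fun j (n : ℤ) => x j ^ n) := by
  classical
  induction s using Finset.induction_on with
  | empty => rw [Finset.sum_empty, Finset.prod_empty, Finsupp.prod_zero_index]
  | insert a s ha ih => rw [Finset.sum_insert ha, Finset.prod_insert ha, lmonomial_add x hx0, ih]

/-- `x^(n • d) = (x^d)^n`, `n ∈ ℕ`. [folklore] -/
theorem lmonomial_nsmul (n : ℕ) (d : κ →₀ ℤ) :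
    (n • d).prod (fun j (n : ℤ) => x j ^ n) = (d.prod fun j (n : ℤ) => x j ^ n) ^ n := by
  induction n with
  | zero => rw [zero_smul, Finsupp.prod_zero_index, pow_zero]
  | succ n ih => rw [succ_nsmul, lmonomial_add x hx0, ih, pow_succ]

/-- `x^(n • d) = (x^d)^n`, `n ∈ ℤ`. [folklore] -/
theorem lmonomial_zsmul (n : ℤ) (d : κ →₀ ℤ) :
    (n • d).prod (fun j (n : ℤ) => x j ^ n) = (d.prod fun j (n : ℤ) => x j ^ n) ^ n := by
  cases n with
  | ofNat n => rw [Int.ofNat_eq_natCast, natCast_zsmul, lmonomial_nsmul x hx0, zpow_natCast]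
  | negSucc n =>
    rw [negSucc_zsmul, lmonomial_neg x hx0, lmonomial_nsmul x hx0, zpow_negSucc]

omit hx0 in
/-- The value of a Laurent monomial. [folklore] -/
theorem valuation_lmonomial (O : ValuationSubring K) (d : κ →₀ ℤ) :
    O.valuation (d.prod fun j (n : ℤ) => x j ^ n) = d.prod fun j (n : ℤ) => O.valuation (x j) ^ n := by
  rw [Finsupp.prod, map_prod]
  simp only [map_zpow₀]
  rfl

end LaurentMonomial

/-! ### The Gauss valuation on `k[B_F][B_E]`: dominant terms -/

section Dominant

variable {k K : Type u} [Field k] [Field K] [Algebra k K]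
variable (O : ValuationSubring K) [Algebra k O] [IsScalarTower k O K]
variable {ι κ : Type*} (y : ι → O) (x : κ → K)

/-- **Dominant term.** Let `y` be elements of `K°` with algebraically independent residues and
`x` non-zero elements whose values are `ℤ`-independent (an Abhyankar system, Temkin 2013, §2.1;
§5.3, p. 55: "the valued subfield `k(B_F) ⊆ K_B` is trivially valued because the set `B̃_F` is
algebraically independent over `k̃`"; proof of Lemma 5.3.2, p. 55: "the valuations of `a` and `b`
are equal to the maximum value of the valuation on the corresponding monomials, for example,
`|a| = maxᵢ |mᵢ|` because `|aᵢ| = 1` and the real numbers `|mᵢ|` are all different"). Then a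
non-zero polynomial `Q` in the `x` with coefficients in `k[y]` has a unique monomial of maximal
value, and the value of `Q(x)` is the value of that monomial. PROVED (ultrametric inequality).
[cite: Temkin2013, proof of Lemma 5.3.2 (p. 55 of arXiv:0804.1554v3)] -/
theorem exists_dominant_monomial (hy : AlgebraicIndependent k fun i => residue O (y i))
    (hx0 : ∀ j, x j ≠ 0)
    (hx : LinearIndependent ℤ fun j =>
      Additive.ofMul (Units.mk0 (O.valuation (x j)) (valuation_ne_zero_of_ne_zero O (hx0 j))))
    (Q : MvPolynomial κ (Algebra.adjoin k (Set.range fun i => (y i : K)))) (hQ : Q ≠ 0) :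
    ∃ μ₀ ∈ Q.support,
      (∀ μ ∈ Q.support, O.valuation (μ.prod fun j (n : ℕ) => x j ^ n) ≤
        O.valuation (μ₀.prod fun j (n : ℕ) => x j ^ n)) ∧
      O.valuation (aeval x Q) = O.valuation (μ₀.prod fun j (n : ℕ) => x j ^ n) := by
  classical
  have hinj := injective_valuation_prod_pow O x hx0 hx
  have hsupp : Q.support.Nonempty := support_nonempty.mpr hQ
  set t : (κ →₀ ℕ) → K := fun μ => ((coeff μ Q : Algebra.adjoin k (Set.range fun i => (y i : K))) : K) *
    μ.prod fun j (n : ℕ) => x j ^ n with ht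
  have haeval : aeval x Q = ∑ μ ∈ Q.support, t μ := by
    simp only [aeval_def, eval₂_eq, ht, Finsupp.prod]
    rfl
  have hval : ∀ μ ∈ Q.support,
      O.valuation (t μ) = O.valuation (μ.prod fun j (n : ℕ) => x j ^ n) := by
    intro μ hμ
    have hc0 : ((coeff μ Q : Algebra.adjoin k (Set.range fun i => (y i : K))) : K) ≠ 0 := by
      have : coeff μ Q ≠ 0 := mem_support_iff.mp hμ
      exact fun h => this (Subtype.ext h)
    have h1 : O.valuation ((coeff μ Q : Algebra.adjoin k (Set.range fun i => (y i : K))) : K) = 1 :=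
      valuation_eq_one_of_mem_adjoin O y hy (coeff μ Q).2 hc0
    simp only [ht, map_mul, h1, one_mul]
  obtain ⟨μ₀, hμ₀, hmax⟩ :=
    Q.support.exists_max_image (fun μ => O.valuation (μ.prod fun j (n : ℕ) => x j ^ n)) hsupp
  refine ⟨μ₀, hμ₀, hmax, ?_⟩
  have hlt : ∀ μ ∈ Q.support \ {μ₀}, O.valuation (t μ) < O.valuation (t μ₀) := by
    intro μ hμ
    rw [Finset.mem_sdiff, Finset.mem_singleton] at hμ
    rw [hval μ hμ.1, hval μ₀ hμ₀]
    exact lt_of_le_of_ne (hmax μ hμ.1) fun h => hμ.2 (hinj h)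
  rw [haeval, Valuation.map_sum_eq_of_lt _ hμ₀ hlt, hval μ₀ hμ₀]

omit [Algebra k O] [IsScalarTower k O K] in
/-- Elements of `k[y][x] = k[y, x]` are polynomials in `x` with coefficients in `k[y]`.
[folklore] -/
theorem exists_mvPolynomial_aeval_eq {s : K}
    (hs : s ∈ Algebra.adjoin k ((Set.range fun i => (y i : K)) ∪ Set.range x)) :
    ∃ Q : MvPolynomial κ (Algebra.adjoin k (Set.range fun i => (y i : K))), aeval x Q = s := by
  have hle : Algebra.adjoin k ((Set.range fun i => (y i : K)) ∪ Set.range x) ≤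
      ((aeval x : MvPolynomial κ (Algebra.adjoin k (Set.range fun i => (y i : K))) →ₐ[_] K)
        |>.range).restrictScalars k := by
    refine Algebra.adjoin_le ?_
    rintro t (⟨i, rfl⟩ | ⟨j, rfl⟩)
    · refine ⟨C ⟨y i, Algebra.subset_adjoin ⟨i, rfl⟩⟩, ?_⟩
      change aeval x (C _) = _
      rw [MvPolynomial.aeval_C]
      rfl
    · refine ⟨X j, ?_⟩
      change aeval x (X j) = x j
      rw [MvPolynomial.aeval_X]
  exact hle hs

end Dominant

/-! ### Toric charts containing finitely many elements (Temkin 2013, §5.1 and Lemma 5.3.2) -/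

section ToricChart

variable {k K : Type u} [Field k] [Field K] [Algebra k K]
variable (O : ValuationSubring K) [Algebra k O] [IsScalarTower k O K]
variable {ι κ : Type*} [Fintype κ] (y : ι → O) (x : κ → K)

/-- **Toric charts** (Temkin 2013, §5.1, p. 51: "If `K = K_B` then `K` can be uniformized by
toric geometry (i.e. essentially combinatorially). Namely, we will see that in this case `K°` is
the filtered union of regular local rings `O_{B,M} = ∪_M k(B_F)[M]_m`, where `M` runs through
free monoids in the valuation monoid `Λ_B ∩ K°`, `Λ_B` is the lattice in `K^×` generated by `B_E`
and `m` is the ideal of `k(B_F)[M]` generated by `M ∖ {1}`"; Lemma 5.3.2, p. 55: "For a fixed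
Abhyankar basis `B` the equality `K_B° = ∪_{M ⊂ Λ°} O_{B,M}` holds", with its proof: "each
element of `K_B` can be represented as `a/b` for `a = a₁m₁ + ⋯ + a_k m_k` and `b = b₁n₁ + ⋯ +
b_l n_l`, where `aᵢ, bⱼ ∈ k(B_F)` and the `mᵢ`'s (resp. `nⱼ`'s) are different elements of `Λ_B`
… Multiply `a` and `b` by an appropriate `m ∈ Λ_B` such that `|b| = 1` … all `mᵢ`'s and `nⱼ`'s
lie in `Λ°`. Choosing a toric monoid `M ⊂ Λ°` which contains all `mᵢ`'s and `nⱼ`'s, we obtain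
that `a ∈ k(B_F)[M^B]` and `b ∈ b₁ + M^B k(B_F)[M^B]`"; combined with Thm. A.2.1, p. 63, to make
`M` FREE). Rendering, for an Abhyankar system `B = x ⊔ y` over the trivially valued `k ⊆ K°`
(`y` in `K°` with algebraically independent residues, `x` non-zero with `ℤ`-independent values)
and finitely many fractions `a_l/b_l ∈ K°` of polynomials in `x` over `k[y]`: there are Laurent
monomials `z₁, …, z_N` in the `x` — a `ℤ`-basis change of the exponent lattice, so that the `xⱼ`
are Laurent monomials in the `zᵢ` — of values `< 1`, such that `(z, y)` is algebraically
independent over `k` (so `k[z, y]` is a polynomial ring inside `K°`, the chart `k(B_F)[M]` with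
`M` free made integral in `y`) and every `a_l/b_l` is `p/q` with `p, q ∈ k[z, y]` and `|q| = 1`
(i.e. lies in the local ring of `k[z, y]` at the centre of `K°`). PROVED, from
`exists_basis_lt_one_of_injective` (`PerronTransforms.lean`) and the dominant-term computation.
[cite: Temkin2013, Section 5.1 (p. 51) and Lemma 5.3.2 (p. 55 of arXiv:0804.1554v3)] -/
theorem exists_toricChart (hy : AlgebraicIndependent k fun i => residue O (y i))
    (hx0 : ∀ j, x j ≠ 0)
    (hx : LinearIndependent ℤ fun j =>
      Additive.ofMul (Units.mk0 (O.valuation (x j)) (valuation_ne_zero_of_ne_zero O (hx0 j))))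
    {σ : Type*} [Fintype σ]
    (a b : σ → MvPolynomial κ (Algebra.adjoin k (Set.range fun i => (y i : K))))
    (hb : ∀ l, b l ≠ 0) (hab : ∀ l, O.valuation (aeval x (a l)) ≤ O.valuation (aeval x (b l))) :
    ∃ (N : ℕ) (z : Fin N → K),
      (∀ i, z i ≠ 0) ∧ (∀ i, O.valuation (z i) < 1) ∧
      AlgebraicIndependent k (Sum.elim z fun i => (y i : K)) ∧
      (∀ j, ∃ r : Fin N → ℤ, x j = ∏ i, z i ^ r i) ∧
      ∀ l, ∃ p q : K, p ∈ Algebra.adjoin k (Set.range (Sum.elim z fun i => (y i : K))) ∧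
        q ∈ Algebra.adjoin k (Set.range (Sum.elim z fun i => (y i : K))) ∧
        O.valuation q = 1 ∧ aeval x (a l) / aeval x (b l) = p / q := by
  classical
  -- Step 0: values of Laurent monomials, as a homomorphism `φ : ℤ^κ → Γˣ`
  let v : (κ →₀ ℤ) → (ValuationSubring.ValueGroup O)ˣ := fun d =>
    Units.mk0 (O.valuation (d.prod fun j (n : ℤ) => x j ^ n))
      (valuation_ne_zero_of_ne_zero O (lmonomial_ne_zero x hx0 d))
  have hv : ∀ d, ((v d : (ValuationSubring.ValueGroup O)ˣ) : ValuationSubring.ValueGroup O) =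
      O.valuation (d.prod fun j (n : ℤ) => x j ^ n) := fun d => rfl
  have hv_add : ∀ d d', v (d + d') = v d * v d' := fun d d' =>
    Units.ext (by rw [Units.val_mul, hv, hv, hv, lmonomial_add x hx0, map_mul])
  let φ : (κ →₀ ℤ) →+ Additive (ValuationSubring.ValueGroup O)ˣ :=
    { toFun := fun d => Additive.ofMul (v d)
      map_zero' := by
        change Additive.ofMul (v 0) = 0
        rw [ofMul_eq_zero]
        exact Units.ext (by rw [hv, Finsupp.prod_zero_index, map_one, Units.val_one])
      map_add' := fun d d' => by
        change Additive.ofMul (v (d + d')) = Additive.ofMul (v d) + Additive.ofMul (v d')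
        rw [hv_add, ofMul_mul] }
  have hφ : ∀ d, φ d = Additive.ofMul (v d) := fun d => rfl
  have hφsingle : ∀ j (n : ℤ), φ (Finsupp.single j n) =
      n • Additive.ofMul (Units.mk0 (O.valuation (x j))
        (valuation_ne_zero_of_ne_zero O (hx0 j))) := by
    intro j n
    rw [hφ, ← ofMul_zpow]
    congr 1
    ext
    rw [hv, lmonomial_single, map_zpow₀, Units.val_zpow_eq_zpow_val, Units.val_mk0]
  have hφlc : φ = (Finsupp.linearCombination ℤ (fun j => Additive.ofMul
      (Units.mk0 (O.valuation (x j)) (valuation_ne_zero_of_ne_zero O (hx0 j))))).toAddMonoidHom := by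
    refine Finsupp.addHom_ext fun j n => ?_
    rw [hφsingle, LinearMap.toAddMonoidHom_coe, Finsupp.linearCombination_single]
  have hφinj : Function.Injective φ := by
    rw [hφlc]
    exact fun d d' h => hx.finsuppLinearCombination_injective h
  -- Step 1: dominant exponents of the denominators and the finite set of exponents
  choose μb hμb hμbmax hμbval using fun l => exists_dominant_monomial O y x hy hx0 hx (b l) (hb l)
  let ιZ : (κ →₀ ℕ) → (κ →₀ ℤ) := fun μ => μ.mapRange (fun n : ℕ => (n : ℤ)) (by simp)
  have hιZ : ∀ μ, (ιZ μ).prod (fun j (n : ℤ) => x j ^ n) = μ.prod fun j (n : ℕ) => x j ^ n :=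
    fun μ => lmonomial_natCast x μ
  let D : Finset (κ →₀ ℤ) := Finset.univ.biUnion fun l =>
    ((a l).support ∪ (b l).support).image fun μ => ιZ μ - ιZ (μb l)
  have hmemD : ∀ l, ∀ μ ∈ (a l).support ∪ (b l).support, ιZ μ - ιZ (μb l) ∈ D :=
    fun l μ hμ => Finset.mem_biUnion.mpr ⟨l, Finset.mem_univ l, Finset.mem_image.mpr ⟨μ, hμ, rfl⟩⟩
  have hbound : ∀ l, ∀ μ ∈ (a l).support ∪ (b l).support,
      O.valuation (μ.prod fun j (n : ℕ) => x j ^ n) ≤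
        O.valuation ((μb l).prod fun j (n : ℕ) => x j ^ n) := by
    intro l μ hμ
    rcases Finset.mem_union.mp hμ with hμ | hμ
    · have ha0 : a l ≠ 0 := by
        rintro h
        rw [h, support_zero] at hμ
        simp at hμ
      obtain ⟨μa, -, hμamax, hμaval⟩ := exists_dominant_monomial O y x hy hx0 hx (a l) ha0
      calc O.valuation (μ.prod fun j (n : ℕ) => x j ^ n)
          ≤ O.valuation (μa.prod fun j (n : ℕ) => x j ^ n) := hμamax μ hμ
        _ = O.valuation (aeval x (a l)) := hμaval.symm
        _ ≤ O.valuation (aeval x (b l)) := hab l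
        _ = O.valuation ((μb l).prod fun j (n : ℕ) => x j ^ n) := hμbval l
    · exact hμbmax l μ hμ
  have hD : ∀ d ∈ D, Additive.toMul (φ d) ≤ 1 := by
    intro d hd
    obtain ⟨l, -, hd⟩ := Finset.mem_biUnion.mp hd
    obtain ⟨μ, hμ, rfl⟩ := Finset.mem_image.mp hd
    rw [map_sub, toMul_sub, div_le_one', hφ, hφ, toMul_ofMul, toMul_ofMul, ← Units.val_le_val,
      hv, hv, hιZ, hιZ]
    exact hbound l μ hμ
  -- Step 2: a positive basis of the exponent lattice (Perron transforms, Thm. A.2.1)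
  haveI : AddGroup.FG (κ →₀ ℤ) := Module.Finite.iff_addGroup_fg.mp inferInstance
  obtain ⟨e, he1, -, hecoef⟩ := exists_basis_lt_one_of_injective φ hφinj D hD
  -- the new variables
  let z : Fin (Module.finrank ℤ (κ →₀ ℤ)) → K := fun i => (e i).prod fun j (n : ℤ) => x j ^ n
  have hz : ∀ i, z i = (e i).prod fun j (n : ℤ) => x j ^ n := fun i => rfl
  have hz0 : ∀ i, z i ≠ 0 := fun i => lmonomial_ne_zero x hx0 _
  have hz1 : ∀ i, O.valuation (z i) < 1 := fun i => by
    have := he1 i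
    rw [hφ, toMul_ofMul, ← Units.val_lt_val, Units.val_one, hv] at this
    exact this
  -- Step 3: `(z, y)` is an Abhyankar system, hence algebraically independent
  have hzli : LinearIndependent ℤ fun i => Additive.ofMul (Units.mk0 (O.valuation (z i))
      (valuation_ne_zero_of_ne_zero O (hz0 i))) := by
    have heq : (fun i => Additive.ofMul (Units.mk0 (O.valuation (z i))
        (valuation_ne_zero_of_ne_zero O (hz0 i)))) = φ.toIntLinearMap ∘ e := by
      funext i
      rfl
    rw [heq]
    exact e.linearIndependent.map' _ (LinearMap.ker_eq_bot.mpr hφinj)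
  have hB : AlgebraicIndependent k (Sum.elim z fun i => (y i : K)) :=
    algebraicIndependent_sumElim_of_valuation O y hy z
      (injective_valuation_prod_pow O z hz0 hzli)
  -- Step 4: the `xⱼ` are Laurent monomials in the `zᵢ`
  have hxz : ∀ j, ∃ r : Fin (Module.finrank ℤ (κ →₀ ℤ)) → ℤ, x j = ∏ i, z i ^ r i := by
    intro j
    refine ⟨fun i => e.repr (Finsupp.single j 1) i, ?_⟩
    calc x j = (Finsupp.single j (1 : ℤ)).prod (fun j (n : ℤ) => x j ^ n) := by
            rw [lmonomial_single, zpow_one]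
      _ = (∑ i, e.repr (Finsupp.single j 1) i • e i).prod (fun j (n : ℤ) => x j ^ n) := by
            rw [e.sum_repr]
      _ = ∏ i, z i ^ (e.repr (Finsupp.single j 1) i) := by
            rw [lmonomial_sum x hx0]
            exact Finset.prod_congr rfl fun i _ => lmonomial_zsmul x hx0 _ _
  -- Step 5: the fractions lie in the local ring of `k[z, y]` at the centre
  have hRF_le : ∀ c : Algebra.adjoin k (Set.range fun i => (y i : K)),
      (c : K) ∈ Algebra.adjoin k (Set.range (Sum.elim z fun i => (y i : K))) := fun c =>
    Algebra.adjoin_mono (by rintro _ ⟨i, rfl⟩; exact ⟨Sum.inr i, rfl⟩) c.2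
  have hzR : ∀ i, z i ∈ Algebra.adjoin k (Set.range (Sum.elim z fun i => (y i : K))) :=
    fun i => Algebra.subset_adjoin ⟨Sum.inl i, rfl⟩
  have hmemR : ∀ l (Q : MvPolynomial κ (Algebra.adjoin k (Set.range fun i => (y i : K)))),
      (∀ μ ∈ Q.support, ιZ μ - ιZ (μb l) ∈ D) →
      aeval x Q * ((ιZ (μb l)).prod fun j (n : ℤ) => x j ^ n)⁻¹ ∈
        Algebra.adjoin k (Set.range (Sum.elim z fun i => (y i : K))) := by
    intro l Q hQ
    rw [MvPolynomial.aeval_def, MvPolynomial.eval₂_eq, Finset.sum_mul]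
    refine Subalgebra.sum_mem _ fun μ hμ => ?_
    obtain ⟨c, hc⟩ := hecoef _ (hQ μ hμ)
    have hmon : (∏ i ∈ μ.support, x i ^ μ i) * ((ιZ (μb l)).prod fun j (n : ℤ) => x j ^ n)⁻¹ =
        ∏ i, z i ^ c i := by
      rw [show (∏ i ∈ μ.support, x i ^ μ i) = μ.prod (fun j (n : ℕ) => x j ^ n) from rfl, ← hιZ,
        ← lmonomial_sub x hx0, hc, lmonomial_sum x hx0]
      exact Finset.prod_congr rfl fun i _ => lmonomial_nsmul x hx0 _ _
    rw [mul_assoc, hmon]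
    exact Subalgebra.mul_mem _ (hRF_le _)
      (Subalgebra.prod_mem _ fun i _ => Subalgebra.pow_mem _ (hzR i) _)
  have hfrac : ∀ l, ∃ p q : K, p ∈ Algebra.adjoin k (Set.range (Sum.elim z fun i => (y i : K))) ∧
      q ∈ Algebra.adjoin k (Set.range (Sum.elim z fun i => (y i : K))) ∧
      O.valuation q = 1 ∧ aeval x (a l) / aeval x (b l) = p / q := by
    intro l
    have hm0 : ((ιZ (μb l)).prod fun j (n : ℤ) => x j ^ n) ≠ 0 := lmonomial_ne_zero x hx0 _
    refine ⟨aeval x (a l) * ((ιZ (μb l)).prod fun j (n : ℤ) => x j ^ n)⁻¹,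
      aeval x (b l) * ((ιZ (μb l)).prod fun j (n : ℤ) => x j ^ n)⁻¹,
      hmemR l (a l) (fun μ hμ => hmemD l μ (Finset.mem_union_left _ hμ)),
      hmemR l (b l) (fun μ hμ => hmemD l μ (Finset.mem_union_right _ hμ)), ?_, ?_⟩
    · rw [map_mul, map_inv₀, hμbval l, hιZ]
      exact mul_inv_cancel₀ (by rw [← hιZ]; exact valuation_ne_zero_of_ne_zero O hm0)
    · exact (mul_div_mul_right _ _ (inv_ne_zero hm0)).symm
  exact ⟨_, z, hz0, hz1, hB, hxz, hfrac⟩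

omit [Algebra k O] [IsScalarTower k O K] [Fintype κ] in
/-- An element of `k(B) ∩ K°` is a quotient `a/b` of polynomials in `x` over `k[y]` with `b ≠ 0`
and `|a| ≤ |b|`. [folklore] -/
theorem exists_aeval_div_aeval_eq (s : K)
    (hsK : s ∈ IntermediateField.adjoin k ((Set.range fun i => (y i : K)) ∪ Set.range x))
    (hsO : s ∈ O) :
    ∃ Qa Qb : MvPolynomial κ (Algebra.adjoin k (Set.range fun i => (y i : K))),
      Qb ≠ 0 ∧ O.valuation (aeval x Qa) ≤ O.valuation (aeval x Qb) ∧
      s = aeval x Qa / aeval x Qb := by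
  classical
  rw [IntermediateField.mem_adjoin_iff] at hsK
  obtain ⟨r, r', rfl⟩ := hsK
  have hmem : ∀ p : MvPolynomial ↥((Set.range fun i => (y i : K)) ∪ Set.range x) k,
      MvPolynomial.aeval Subtype.val p ∈
        Algebra.adjoin k ((Set.range fun i => (y i : K)) ∪ Set.range x) := fun p => by
    have h := Algebra.adjoin_range_eq_range_aeval k
      (Subtype.val : ↥((Set.range fun i => (y i : K)) ∪ Set.range x) → K)
    rw [Subtype.range_coe] at h
    rw [h]
    exact ⟨p, rfl⟩
  by_cases h0 : MvPolynomial.aeval Subtype.val r' = 0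
  · refine ⟨0, 1, one_ne_zero, by simp, ?_⟩
    rw [h0, div_zero, map_zero, map_one, zero_div]
  obtain ⟨Qa, hQa⟩ := exists_mvPolynomial_aeval_eq O y x (hmem r)
  obtain ⟨Qb, hQb⟩ := exists_mvPolynomial_aeval_eq O y x (hmem r')
  refine ⟨Qa, Qb, ?_, ?_, by rw [hQa, hQb]⟩
  · rintro rfl
    rw [map_zero] at hQb
    exact h0 hQb.symm
  · rw [hQa, hQb]
    have hd : O.valuation (MvPolynomial.aeval Subtype.val r') ≠ 0 := (Valuation.ne_zero_iff _).mpr h0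
    have h1 : O.valuation (MvPolynomial.aeval Subtype.val r) /
        O.valuation (MvPolynomial.aeval Subtype.val r') ≤ 1 := by
      rw [← map_div₀]
      exact (O.valuation_le_one_iff _).mpr hsO
    calc O.valuation (MvPolynomial.aeval Subtype.val r)
        = O.valuation (MvPolynomial.aeval Subtype.val r) /
            O.valuation (MvPolynomial.aeval Subtype.val r') *
            O.valuation (MvPolynomial.aeval Subtype.val r') := (div_mul_cancel₀ _ hd).symm
      _ ≤ 1 * O.valuation (MvPolynomial.aeval Subtype.val r') := mul_le_mul_left h1 _
      _ = O.valuation (MvPolynomial.aeval Subtype.val r') := one_mul _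

/-- `k[w] ⊆ K°` for a finite family `w` of elements of `K°` (and `k ⊆ K°`). [folklore] -/
theorem adjoin_toSubring_le_of_mem {τ : Type*} (w : τ → K) (hw : ∀ t, w t ∈ O) :
    (Algebra.adjoin k (Set.range w)).toSubring ≤ O.toSubring := by
  let Oalg : Subalgebra k K :=
    { O.toSubring with algebraMap_mem' := algebraMap_mem_of_isScalarTower O }
  have h : Algebra.adjoin k (Set.range w) ≤ Oalg := Algebra.adjoin_le (by rintro _ ⟨t, rfl⟩; exact hw t)
  exact fun t ht => h ht

/-- A polynomial ring over a field, presented as `k[w]` for an algebraically independent finite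
family `w`, is a regular ring (Mathlib: `MvPolynomial.isRegularRing_of_isRegularRing`).
[folklore] -/
theorem isRegularRing_adjoin_of_algebraicIndependent {τ : Type*} [Finite τ] (w : τ → K)
    (hw : AlgebraicIndependent k w) : IsRegularRing ↥(Algebra.adjoin k (Set.range w)) :=
  IsRegularRing.of_ringEquiv hw.aevalEquiv.toRingEquiv

/-- **`K_B°` is a filtered union of regular local rings `O_{B,M}`** (Temkin 2013, §5.1, p. 51,
and Lemma 5.3.2 with Thm. A.2.1; see `exists_toricChart`): for an Abhyankar system `B = x ⊔ y`
over the trivially valued `k` and finitely many elements `s_l ∈ k(B) ∩ K°` there is a toric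
chart `k[z, y] ⊆ K°` — `z` Laurent monomials in `x` of values `< 1` with `(z, y)` algebraically
independent and the `xⱼ` Laurent monomials in `z` — whose local ring at the centre of `K°` is a
REGULAR local ring containing every `s_l` (each `s_l = p/q`, `p, q ∈ k[z, y]`, `|q| = 1`).
PROVED. [cite: Temkin2013, Section 5.1 (p. 51) and Lemma 5.3.2 (p. 55 of arXiv:0804.1554v3)] -/
theorem exists_regular_toricChart [Finite ι] (hy : AlgebraicIndependent k fun i => residue O (y i))
    (hx0 : ∀ j, x j ≠ 0)
    (hx : LinearIndependent ℤ fun j =>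
      Additive.ofMul (Units.mk0 (O.valuation (x j)) (valuation_ne_zero_of_ne_zero O (hx0 j))))
    {σ : Type*} [Fintype σ] (s : σ → K)
    (hsK : ∀ l, s l ∈ IntermediateField.adjoin k ((Set.range fun i => (y i : K)) ∪ Set.range x))
    (hsO : ∀ l, s l ∈ O) :
    ∃ (N : ℕ) (z : Fin N → K)
      (hRO : (Algebra.adjoin k (Set.range (Sum.elim z fun i => (y i : K)))).toSubring ≤
        O.toSubring),
      (∀ i, z i ≠ 0) ∧ (∀ i, O.valuation (z i) < 1) ∧
      AlgebraicIndependent k (Sum.elim z fun i => (y i : K)) ∧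
      (∀ j, ∃ r : Fin N → ℤ, x j = ∏ i, z i ^ r i) ∧
      IsRegularLocalRing (Localization.AtPrime
        (centreIdeal (Algebra.adjoin k (Set.range (Sum.elim z fun i => (y i : K)))) O hRO)) ∧
      ∀ l, ∃ p q : K, p ∈ Algebra.adjoin k (Set.range (Sum.elim z fun i => (y i : K))) ∧
        q ∈ Algebra.adjoin k (Set.range (Sum.elim z fun i => (y i : K))) ∧
        O.valuation q = 1 ∧ s l = p / q := by
  classical
  choose Qa Qb hQb hab hs using fun l => exists_aeval_div_aeval_eq O y x (s l) (hsK l) (hsO l)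
  obtain ⟨N, z, hz0, hz1, hB, hxz, hfrac⟩ := exists_toricChart O y x hy hx0 hx Qa Qb hQb hab
  have hRO : (Algebra.adjoin k (Set.range (Sum.elim z fun i => (y i : K)))).toSubring ≤
      O.toSubring := by
    refine adjoin_toSubring_le_of_mem O _ ?_
    rintro (i | i)
    · exact (O.valuation_le_one_iff _).mp (hz1 i).le
    · exact (y i).2
  haveI : IsRegularRing ↥(Algebra.adjoin k (Set.range (Sum.elim z fun i => (y i : K)))) :=
    isRegularRing_adjoin_of_algebraicIndependent _ hB
  refine ⟨N, z, hRO, hz0, hz1, hB, hxz, inferInstance, fun l => ?_⟩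
  obtain ⟨p, q, hp, hq, hq1, h⟩ := hfrac l
  exact ⟨p, q, hp, hq, hq1, (hs l).trans h⟩

end ToricChart

/-! ### Local uniformization of `K = k(B)` by refining any affine model -/

section Model

variable {k K : Type u} [Field k] [Field K] [Algebra k K]
variable (O : ValuationSubring K) [Algebra k O] [IsScalarTower k O K]
variable {ι κ : Type*} [Fintype ι] [Fintype κ] (y : ι → O) (x : κ → K)

omit [Algebra k O] [IsScalarTower k O K] [Fintype ι] [Fintype κ] in
/-- The subfield generated by a toric chart `k[z, y]` contains `k(x, y)` when the `xⱼ` are Laurent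
monomials in `z`; hence it is all of `K` if `K = k(x, y)`. [folklore] -/
theorem subfield_closure_adjoin_eq_top {N : ℕ} (z : Fin N → K)
    (hxz : ∀ j, ∃ r : Fin N → ℤ, x j = ∏ i, z i ^ r i)
    (hK : IntermediateField.adjoin k ((Set.range fun i => (y i : K)) ∪ Set.range x) = ⊤) :
    Subfield.closure (Algebra.adjoin k (Set.range (Sum.elim z fun i => (y i : K))) : Set K) = ⊤ := by
  refine eq_top_iff.mpr ?_
  have htop : (⊤ : Subfield K) = (IntermediateField.adjoin k
      ((Set.range fun i => (y i : K)) ∪ Set.range x)).toSubfield := by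
    rw [hK]; rfl
  rw [htop]
  change Subfield.closure (Set.range (algebraMap k K) ∪
      ((Set.range fun i => (y i : K)) ∪ Set.range x)) ≤ _
  refine Subfield.closure_le.mpr ?_
  rintro t (⟨c, rfl⟩ | ⟨i, rfl⟩ | ⟨j, rfl⟩)
  · exact Subfield.subset_closure (Subalgebra.algebraMap_mem _ c)
  · exact Subfield.subset_closure (Algebra.subset_adjoin ⟨Sum.inr i, rfl⟩)
  · obtain ⟨r, hr⟩ := hxz j
    rw [hr]
    refine Subfield.prod_mem _ fun i _ => Subfield.zpow_mem _ (Subfield.subset_closure ?_) _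
    exact Algebra.subset_adjoin (Set.mem_range.mpr ⟨Sum.inl i, rfl⟩)

omit [Algebra k O] [IsScalarTower k O K] [Fintype ι] [Fintype κ] in
/-- A subalgebra generating `K` as a field has fraction field `K`. [folklore] -/
theorem isFractionRing_of_subfield_closure_eq_top (R : Subalgebra k K)
    (hR : Subfield.closure (R : Set K) = ⊤) : IsFractionRing R K := by
  refine IsFractionRing.of_field R K fun t => ?_
  have ht : t ∈ Subfield.closure (R : Set K) := hR ▸ Subfield.mem_top t
  rw [Subfield.mem_closure_iff] at ht
  obtain ⟨a, ha, b, hb, rfl⟩ := ht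
  have hcl : Subring.closure (R : Set K) = R.toSubring := by
    rw [← Subalgebra.coe_toSubring, Subring.closure_eq]
  rw [hcl] at ha hb
  exact ⟨⟨a, ha⟩, ⟨b, hb⟩, rfl⟩

/-- **Toric local uniformization, model form** (Temkin 2013, Thm. 1.3.2 in the case `K = K_B`,
with `l = k`, `L = K`: §5.1, p. 51: "for a large enough `M` a neighborhood of `η_{B,M}` will turn
out to be finer than any fixed model of `K°`. In particular, this is enough to uniformize `K`
when `K = K_B`"): if `K = k(x, y)` for an Abhyankar system `B = x ⊔ y` of `K°` over the trivially
valued `k`, then EVERY affine model `A ⊆ K°` (finitely generated `k`-subalgebra) is refined by an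
affine model `B ⊇ A` of `K°` inside `K°` (finitely generated, `Frac B = K`) whose local ring at the
centre of `K°` is a regular local ring — namely `B = k[z, y][1/q]` for a toric chart `k[z, y]`
containing the generators of `A` in its local ring. PROVED; no extension of `k` or `K` is needed.
[cite: Temkin2013, Section 5.1 (p. 51 of arXiv:0804.1554v3)] -/
theorem exists_regular_affineModel_of_toric (hy : AlgebraicIndependent k fun i => residue O (y i))
    (hx0 : ∀ j, x j ≠ 0)
    (hx : LinearIndependent ℤ fun j =>
      Additive.ofMul (Units.mk0 (O.valuation (x j)) (valuation_ne_zero_of_ne_zero O (hx0 j))))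
    (hK : IntermediateField.adjoin k ((Set.range fun i => (y i : K)) ∪ Set.range x) = ⊤)
    (A : Subalgebra k K) (hAO : A.toSubring ≤ O.toSubring) (hAfg : A.FG) :
    ∃ (B : Subalgebra k K) (hBO : B.toSubring ≤ O.toSubring), A ≤ B ∧ B.FG ∧
      IsFractionRing B K ∧ IsRegularLocalRing (Localization.AtPrime (centreIdeal B O hBO)) := by
  classical
  obtain ⟨S, hS⟩ := hAfg
  have hsK : ∀ l : ↥S, (l : K) ∈ IntermediateField.adjoin k
      ((Set.range fun i => (y i : K)) ∪ Set.range x) := fun l => by rw [hK]; trivial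
  have hsO : ∀ l : ↥S, (l : K) ∈ O := fun l =>
    hAO (show (l : K) ∈ A from hS ▸ Algebra.subset_adjoin l.2)
  obtain ⟨N, z, hRO, hz0, hz1, hB, hxz, hreg, hfrac⟩ :=
    exists_regular_toricChart O y x hy hx0 hx (fun l : ↥S => (l : K)) hsK hsO
  choose p q hp hq hq1 hpq using hfrac
  set R : Subalgebra k K := Algebra.adjoin k (Set.range (Sum.elim z fun i => (y i : K))) with hRdef
  -- the common denominator
  let β : K := ∏ l, q l
  have hβR : β ∈ R := Subalgebra.prod_mem _ fun l _ => hq l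
  have hβ1 : O.valuation β = 1 := by
    rw [map_prod]
    exact Finset.prod_eq_one fun l _ => hq1 l
  have hβ0 : β ≠ 0 := fun h => by
    rw [h, map_zero] at hβ1
    exact zero_ne_one hβ1
  have hq0 : ∀ l, q l ≠ 0 := fun l h => by
    have := hq1 l
    rw [h, map_zero] at this
    exact zero_ne_one this
  -- the refined model `B = R[1/β]`
  refine ⟨locAway R β hβR, locAway_le_valuationSubring hRO hβ1, ?_, ?_, ?_, ?_⟩
  · -- `A ≤ B`
    rw [← hS]
    refine Algebra.adjoin_le fun t ht => ?_
    rw [SetLike.mem_coe, mem_locAway_iff_exists_div hβ0]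
    refine ⟨p ⟨t, ht⟩ * ∏ l ∈ Finset.univ.erase ⟨t, ht⟩, q l, ?_, 1, ?_⟩
    · exact Subalgebra.mul_mem _ (hp _) (Subalgebra.prod_mem _ fun l _ => hq l)
    · rw [pow_one]
      have hsplit : β = q ⟨t, ht⟩ * ∏ l ∈ Finset.univ.erase ⟨t, ht⟩, q l :=
        (Finset.mul_prod_erase Finset.univ q (Finset.mem_univ _)).symm
      rw [hsplit, mul_div_mul_right _ _ (Finset.prod_ne_zero_iff.mpr fun l _ => hq0 l)]
      exact hpq ⟨t, ht⟩
  · -- finitely generated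
    refine fg_locAway hβ0 ⟨(Set.finite_range (Sum.elim z fun i => (y i : K))).toFinset, ?_⟩
    rw [Set.Finite.coe_toFinset]
  · -- `Frac B = K`
    haveI : IsFractionRing R K :=
      isFractionRing_of_subfield_closure_eq_top R (subfield_closure_adjoin_eq_top O y x z hxz hK)
    refine IsFractionRing.of_field _ K fun t => ?_
    obtain ⟨a, b, -, rfl⟩ := IsFractionRing.div_surjective (A := R) t
    exact ⟨⟨a, le_locAway (B := R) (f := β) (hf := hβR) a.2⟩,
      ⟨b, le_locAway (B := R) (f := β) (hf := hβR) b.2⟩, rfl⟩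
  · -- regularity at the centre, by the sandwich `R ⊆ B ⊆ R_𝔭`
    haveI : IsFractionRing R K :=
      isFractionRing_of_subfield_closure_eq_top R (subfield_closure_adjoin_eq_top O y x z hxz hK)
    have hle : R.toSubring ≤ (locAway R β hβR).toSubring := fun t ht =>
      le_locAway (B := R) (f := β) (hf := hβR) ht
    haveI hfr : IsFractionRing R.toSubring K := ‹IsFractionRing R K›
    refine @isRegularLocalRing_localization_of_sandwich K _ R.toSubring (locAway R β hβR).toSubring
      hle hfr (centreIdeal (locAway R β hβR) O (locAway_le_valuationSubring hRO hβ1))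
      (centreIdeal.isPrime _ O _) (centreIdeal R O hRO) (centreIdeal.isPrime R O hRO) ?_ ?_ hreg
    · change Ideal.comap _ (Ideal.comap _ _) = Ideal.comap _ _
      rw [Ideal.comap_comap]
      exact congrArg (fun f => Ideal.comap f (IsLocalRing.maximalIdeal O)) (RingHom.ext fun _ => rfl)
    · intro t
      obtain ⟨n, hn⟩ : ∃ n : ℕ, (t : K) * β ^ n ∈ R := t.2
      refine ⟨⟨(t : K) * β ^ n, hn⟩, ⟨β ^ n, Subalgebra.pow_mem _ hβR n⟩, ?_, rfl⟩
      change (⟨β ^ n, _⟩ : (locAway R β hβR).toSubring) ∉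
        Ideal.comap _ (IsLocalRing.maximalIdeal O)
      rw [Ideal.mem_comap]
      intro hmem
      have hlt : O.valuation (β ^ n) < 1 :=
        (ValuationSubring.valuation_lt_one_iff O _).mp hmem
      rw [map_pow, hβ1, one_pow] at hlt
      exact lt_irrefl _ hlt

/-- **Toric local uniformization** (Temkin 2013, §5.1, the case `K = K_B`): if `K = k(x, y)` for
an Abhyankar system `B = x ⊔ y` of `K°` over the trivially valued `k` (`y ∈ K°` with algebraically
independent residues, `x ≠ 0` with `ℤ`-independent values; these are the finitely generated
Abhyankar valued fields with `K = K_B` of §5.1), then `K°` is locally uniformizable over `k`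
(`IsLocallyUniformizable`, `LocalUniformization.lean`). PROVED.
[cite: Temkin2013, Section 5.1 (p. 51 of arXiv:0804.1554v3)] -/
theorem isLocallyUniformizable_of_toric (hy : AlgebraicIndependent k fun i => residue O (y i))
    (hx0 : ∀ j, x j ≠ 0)
    (hx : LinearIndependent ℤ fun j =>
      Additive.ofMul (Units.mk0 (O.valuation (x j)) (valuation_ne_zero_of_ne_zero O (hx0 j))))
    (hK : IntermediateField.adjoin k ((Set.range fun i => (y i : K)) ∪ Set.range x) = ⊤) :
    IsLocallyUniformizable k K O := by
  obtain ⟨B, hBO, -, hBfg, hBfr, hreg⟩ := exists_regular_affineModel_of_toric O y x hy hx0 hx hK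
    ⊥ (fun t ht => by
      obtain ⟨c, rfl⟩ := Algebra.mem_bot.mp ht
      exact algebraMap_mem_of_isScalarTower O c) Subalgebra.fg_bot
  exact ⟨B, hBO, hBfg, hBfr, hreg⟩

/-- **The conclusion of `Temkin2013` in the toric case, with `L = K`** (Temkin 2013, Thm. 1.3.2
for `K = K_B`, §5.1): no purely inseparable extension is needed. PROVED special case of the
named fact `Temkin2013` (`LocalUniformization.lean`).
[cite: Temkin2013, Section 5.1 (p. 51 of arXiv:0804.1554v3)] -/
theorem temkin2013_conclusion_of_toric (hy : AlgebraicIndependent k fun i => residue O (y i))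
    (hx0 : ∀ j, x j ≠ 0)
    (hx : LinearIndependent ℤ fun j =>
      Additive.ofMul (Units.mk0 (O.valuation (x j)) (valuation_ne_zero_of_ne_zero O (hx0 j))))
    (hK : IntermediateField.adjoin k ((Set.range fun i => (y i : K)) ∪ Set.range x) = ⊤) :
    ∃ (L : Type u) (_ : Field L) (_ : Algebra K L) (_ : Algebra k L) (_ : IsScalarTower k K L),
      FiniteDimensional K L ∧ IsPurelyInseparable K L ∧
      ∃ O' : ValuationSubring L, O'.comap (algebraMap K L) = O ∧ IsLocallyUniformizable k L O' := by
  refine ⟨K, inferInstance, inferInstance, inferInstance, inferInstance, inferInstance,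
    inferInstance, O, ?_, isLocallyUniformizable_of_toric O y x hy hx0 hx hK⟩
  ext t
  simp

end Model

end Literature.AlgebraicGeometry.Resolution
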